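import Summits.Ventures.CertifiedManyBodySolver.Downfold.BoxesLa214V115M2cPhaseSeparationThermalCuprateAnchor
import Summits.Ventures.CertifiedManyBodySolver.Downfold.BoxesLa214V115M2cPhaseSeparationZeeman
import HarnessLib

/-!
# Ventures/CertifiedManyBodySolver — Downfold/BoxesLa214V115M2cPhaseSeparationZeemanCuprateAnchor.lean: the `H` axis of the LSCO `x = 1/8`
# competing-orders cell RE-ANCHORED on the cuprate-point `t–t′` C1 node — on `t′/t ∈ [−1/4, −1/5] × U/t ∈ [8, 81/10]` the `(≤ 1/5 | ≥ 1)`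
# coexistence is excluded among canonical FIELD equilibrium states for every `β ≥ 15` and every Zeeman field `|h| ≤ t/100` (was `β ≥ 28`),
# for every `β ≥ 14` and `|h| ≤ t/200`; `(≤ 1/4 | ≥ 1)` for every `β ≥ 30` and `|h| ≤ t/100` (was `54`)

HONEST FRAMING: first certified bounds; not a superconductivity verdict. CLASS = DERIVED / CONTEXT on a SCREENING-GRADE material box — the
`T > 0 × H` companion of `Downfold/BoxesLa214V115M2cPhaseSeparationThermalCuprateAnchor.lean` (this seat, g24; zero field `β ≥ 12` / `21`) and the
re-anchored edition of `Downfold/BoxesLa214V115M2cPhaseSeparationZeeman{,Cells}.lean` (g21; `β ≥ 28 ∀ |h| ≤ 1/100` on the whole cell): the zero-field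
column forms of `Observables/PhaseSeparationExclusionBoxZeeman.lean` (`psHT_not_fieldEquilibrium_mix_above_column_hotAnchor`: the Zeeman energy moves
the margin by at most `|h|·(a n₁ + b n₂) = (7/8)|h|`, law `sub_mul_field_lt_pressureTT'Zeeman_mix_of_hotAnchors_of_threshold_of_abs_le`) with
EXACTLY the parents' inputs — VARBOX plane `cert_obx32x4tpm1o4D1200_openbox_32x4_N112_planes`, K2DIAG-A bootstrap
`cert_laBoxE_K2diag_GU8n1tpm3o10_j299783_up`, registry #472 · #428, kernel Fermi-sea rows, dilute entropy caps — and hubbard-thermal-eng-4's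
cuprate-point staircase node `cert_feC1tt_stair221_tpm1o4_b2_j300793` READ AT `n = 1` on the band `|t′| ≤ 1/4 × U ≥ 8`
(`lsco_hotCap_n1_b2_j300793_on_cell`). CONTROL class (partner phase dilute, hole doping `≥ 80 %` / `≥ 75 %`); Zeeman coupling only (no orbital
field); statements about translation-invariant canonical field equilibrium states in the variational sense (at `h = 0` they contain every
sector-Gibbs torus limit); conditional BY NAME on the claim nodes; nothing about stripes / superconductivity / `T_c` / critical fields;
nothing about La₁.₈₇₅Sr₀.₁₂₅CuO₄ itself; no number of record. Zero compute, no `sorry`.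

Cell `pub/hubbard-downfold` (MO-S1 ↔ S2 seam; D-0096 (ii)/(iii) + D-0098 `T × H` axes), seat `hubbard-downfold-unc-2` (g24). THRESHOLDS (exact,
`gen-g24/gen_fileE.py`; far end `(s, U) = (−1/4, 81/10)` binds; `N = aπ₁ + bΠ + 2·b·L₈(s)`, margin `M − h₀·(a n₁ + b)`):
* §1 `(≤ 1/5 | ≥ 1)`: `|h| ≤ 1/100`: `M − 7/800 = 0.0361`, `β₀ = 14.7` ⇒ every `β ≥ 15` — `T ≲ 263–309 K`, `B ≲ 59–69 T` at `t ∈ [0.34, 0.40]` eV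
  [float; `h = μ_B B`]; `|h| ≤ 1/200`: `β₀ = 13.1` ⇒ every `β ≥ 14`;
* §2 `(≤ 1/4 | ≥ 1)`: `|h| ≤ 1/100`: `M − 7/800 = 0.0185`, `β₀ = 29.7` ⇒ every `β ≥ 30` (g21: `54` on `[79/10, 81/10]`).
READING (D-0098 `T × P × H` annotation, CONTROL): «LSCO x = 1/8 one-band box, right t′-half × U/t ∈ [8.0, 8.1]: the competing-order word ‹no
macroscopic (≤1/5∣≥1) phase separation› is constant along the whole laboratory H axis (≤ 60 T) at every T ≲ 260 K».
WHAT THIS IS NOT: a certificate; a statement at other `U`, `t′`, `β`, `h`; an `H_c2` / stripe / SC sentence; the anchor is a PRODUCER-CERTIFIED node.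
References: [Israel1979] Thm I.2.4; [PoulinHastings2011]; [Griffiths1964]; [EmeryKivelsonLin1990].
-/

noncomputable section

namespace Summit.Ventures.CertifiedManyBodySolver.Downfold

open Summit.Ventures.CertifiedManyBodySolver.Observables
open Summit.Ventures.CertifiedManyBodySolver.Certificates
open Literature.MathematicalPhysics.QuantumLattice Literature.MathematicalPhysics.QuantumLattice.ThermodynamicLimit
open Literature.MathematicalPhysics.QuantumLattice.InfVolFermionState Set Filter

/-! ## §1 `(≤ 1/5 | ≥ 1)` on `t′ ∈ [−1/4, −1/5] × U ∈ [8, 81/10]`: every `β ≥ 15` and `|h| ≤ 1/100`; every `β ≥ 14` and `|h| ≤ 1/200` -/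

/-- **THE `T > 0 × H` SENTENCE `(≤ 1/5 | ≥ 1)` on `t′ ∈ [−1/4, −1/5] × U ∈ [8, 81/10]`, every `β ≥ 15`, every `|h| ≤ 1/100`** (`β₀ = 14.7`; g21: `β ≥ 28`): for every `(s, U)` of the sub-cell, no mixture `λω₁ + (1−λ)ω₂` of translation-invariant states with densities `0 < ρ(ω₁) ≤ 1/5`, `1 ≤ ρ(ω₂) < 2` is a canonical field equilibrium state at `(β; 1, s, U; h)` — its free-energy functional lies strictly below the Zeeman pressure at its density. [cite: Israel1979, Thm. I.2.4] [cite: PoulinHastings2011, eqs. (3)–(8)] [cite: Griffiths1964, §II] -/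
theorem lsco78_not_fieldEquilibrium_mix_le_1o5_ge_one_beta15_of_abs_le_1o100_tpm1o4_1o5 (hVB : cert_obx32x4tpm1o4D1200_openbox_32x4_N112_planes)
    (hK8 : cert_laBoxE_K2diag_GU8n1tpm3o10_j299783_up)
    (h472 : cert_r472_pb2_tl_upper_n1_U8) (h428 : cert_r428_hubSQ_hanK7R6_U8_r5_e4_so4blk)
    (hC1 : cert_feC1tt_stair221_tpm1o4_b2_j300793)
    {s : ℝ} (hs : s ∈ Icc (-1 / 4 : ℝ) (-1 / 5)) {U : ℝ} (hU : U ∈ Icc (8 : ℝ) (81 / 10))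
    {β : ℝ} (hβ : (15 : ℝ) ≤ β) {hz : ℝ} (hh : |hz| ≤ 1 / 100)
    {ω₁ ω₂ : InfVolFermionState 2} (h₁ : ω₁.IsTranslationInvariant) (h₂ : ω₂.IsTranslationInvariant)
    (hρ₁ : 0 < ω₁.density) (hρ₁' : ω₁.density ≤ 1 / 5) (hρ₂ : 1 ≤ ω₂.density) (hρ₂' : ω₂.density < 2)
    {lam : ℝ} (hl0 : 0 < lam) (hl1 : lam < 1) :
    (mix lam hl0.le hl1.le ω₁ ω₂).entropyDensitySup -
        β * (mix lam hl0.le hl1.le ω₁ ω₂).meanEnergy (gcInteractionTT' 1 s U 0 hz) 1 <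
      pressureTT'Zeeman β 1 s U (mix lam hl0.le hl1.le ω₁ ω₂).density hz := by
  refine psHT_not_fieldEquilibrium_mix_above_column_hotAnchor 1 (s₁ := -1 / 4) (s₂ := -1 / 5) (U₂ := 8) (U₃ := 81 / 10)
    (n₁ := 1 / 5) (n₂ := 1) (a := 5 / 32) (b := 27 / 32) (β₀ := 15) (βh₁ := 0) (βh₂ := 2)
    (π₁ := 0.666) (π₂ := 3994878420865131 / 2251799813685248) (h₀ := 1 / 100)
    (by norm_num) (by norm_num) (by norm_num) (by norm_num) (by norm_num) (by norm_num) (by norm_num) (by norm_num)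
    (by norm_num) (by norm_num) (by norm_num) (by norm_num) hβ (by norm_num)
    (lsco78_capPlane_on_cell_of hVB (by norm_num) (by norm_num) (by norm_num))
    (fun s hs => lsco_n1_law8_of hK8 h472 h428 s ⟨hs.1.trans' (by norm_num), hs.2.trans (by norm_num)⟩)
    (fun s hs U hU => lsco_dilute14_floor_right (n₁ := 1 / 5) (by norm_num) (by norm_num) s hs U (by linarith [hU.1]))
    (lsco_diluteCap_1o5 (by norm_num))
    (lsco_hotCap_n1_b2_j300793_on_cell hC1 (by norm_num) (by norm_num) (by norm_num))
    hh ?_ ?_ hs hU h₁ h₂ hρ₁ hρ₁' hρ₂ hρ₂' hl0 hl1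
  · intro s hs; obtain ⟨h1, h2⟩ := hs; push_cast; norm_num; nlinarith [h1, h2]
  · intro s hs; obtain ⟨h1, h2⟩ := hs; push_cast; norm_num; nlinarith [h1, h2]

/-- **`(≤ 1/5 | ≥ 1)` on `t′ ∈ [−1/4, −1/5] × U ∈ [8, 81/10]`, every `β ≥ 14`, every `|h| ≤ 1/200`** (`β₀ = 13.1`; `B ≲ 30 T`). [cite: Israel1979, Thm. I.2.4] [cite: PoulinHastings2011, eqs. (3)–(8)] [cite: Griffiths1964, §II] -/
theorem lsco78_not_fieldEquilibrium_mix_le_1o5_ge_one_beta14_of_abs_le_1o200_tpm1o4_1o5 (hVB : cert_obx32x4tpm1o4D1200_openbox_32x4_N112_planes)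
    (hK8 : cert_laBoxE_K2diag_GU8n1tpm3o10_j299783_up)
    (h472 : cert_r472_pb2_tl_upper_n1_U8) (h428 : cert_r428_hubSQ_hanK7R6_U8_r5_e4_so4blk)
    (hC1 : cert_feC1tt_stair221_tpm1o4_b2_j300793)
    {s : ℝ} (hs : s ∈ Icc (-1 / 4 : ℝ) (-1 / 5)) {U : ℝ} (hU : U ∈ Icc (8 : ℝ) (81 / 10))
    {β : ℝ} (hβ : (14 : ℝ) ≤ β) {hz : ℝ} (hh : |hz| ≤ 1 / 200)
    {ω₁ ω₂ : InfVolFermionState 2} (h₁ : ω₁.IsTranslationInvariant) (h₂ : ω₂.IsTranslationInvariant)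
    (hρ₁ : 0 < ω₁.density) (hρ₁' : ω₁.density ≤ 1 / 5) (hρ₂ : 1 ≤ ω₂.density) (hρ₂' : ω₂.density < 2)
    {lam : ℝ} (hl0 : 0 < lam) (hl1 : lam < 1) :
    (mix lam hl0.le hl1.le ω₁ ω₂).entropyDensitySup -
        β * (mix lam hl0.le hl1.le ω₁ ω₂).meanEnergy (gcInteractionTT' 1 s U 0 hz) 1 <
      pressureTT'Zeeman β 1 s U (mix lam hl0.le hl1.le ω₁ ω₂).density hz := by
  refine psHT_not_fieldEquilibrium_mix_above_column_hotAnchor 1 (s₁ := -1 / 4) (s₂ := -1 / 5) (U₂ := 8) (U₃ := 81 / 10)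
    (n₁ := 1 / 5) (n₂ := 1) (a := 5 / 32) (b := 27 / 32) (β₀ := 14) (βh₁ := 0) (βh₂ := 2)
    (π₁ := 0.666) (π₂ := 3994878420865131 / 2251799813685248) (h₀ := 1 / 200)
    (by norm_num) (by norm_num) (by norm_num) (by norm_num) (by norm_num) (by norm_num) (by norm_num) (by norm_num)
    (by norm_num) (by norm_num) (by norm_num) (by norm_num) hβ (by norm_num)
    (lsco78_capPlane_on_cell_of hVB (by norm_num) (by norm_num) (by norm_num))
    (fun s hs => lsco_n1_law8_of hK8 h472 h428 s ⟨hs.1.trans' (by norm_num), hs.2.trans (by norm_num)⟩)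
    (fun s hs U hU => lsco_dilute14_floor_right (n₁ := 1 / 5) (by norm_num) (by norm_num) s hs U (by linarith [hU.1]))
    (lsco_diluteCap_1o5 (by norm_num))
    (lsco_hotCap_n1_b2_j300793_on_cell hC1 (by norm_num) (by norm_num) (by norm_num))
    hh ?_ ?_ hs hU h₁ h₂ hρ₁ hρ₁' hρ₂ hρ₂' hl0 hl1
  · intro s hs; obtain ⟨h1, h2⟩ := hs; push_cast; norm_num; nlinarith [h1, h2]
  · intro s hs; obtain ⟨h1, h2⟩ := hs; push_cast; norm_num; nlinarith [h1, h2]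

/-! ## §2 `(≤ 1/4 | ≥ 1)` on `t′ ∈ [−1/4, −1/5] × U ∈ [8, 81/10]`: every `β ≥ 30` and `|h| ≤ 1/100` -/

/-- **`(≤ 1/4 | ≥ 1)` on `t′ ∈ [−1/4, −1/5] × U ∈ [8, 81/10]`, every `β ≥ 30`, every `|h| ≤ 1/100`** (`β₀ = 29.7`; g21: `β ≥ 54` on `[79/10, 81/10]`). [cite: Israel1979, Thm. I.2.4] [cite: PoulinHastings2011, eqs. (3)–(8)] [cite: Griffiths1964, §II] -/
theorem lsco78_not_fieldEquilibrium_mix_le_1o4_ge_one_beta30_of_abs_le_1o100_tpm1o4_1o5 (hVB : cert_obx32x4tpm1o4D1200_openbox_32x4_N112_planes)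
    (hK8 : cert_laBoxE_K2diag_GU8n1tpm3o10_j299783_up)
    (h472 : cert_r472_pb2_tl_upper_n1_U8) (h428 : cert_r428_hubSQ_hanK7R6_U8_r5_e4_so4blk)
    (hC1 : cert_feC1tt_stair221_tpm1o4_b2_j300793)
    {s : ℝ} (hs : s ∈ Icc (-1 / 4 : ℝ) (-1 / 5)) {U : ℝ} (hU : U ∈ Icc (8 : ℝ) (81 / 10))
    {β : ℝ} (hβ : (30 : ℝ) ≤ β) {hz : ℝ} (hh : |hz| ≤ 1 / 100)
    {ω₁ ω₂ : InfVolFermionState 2} (h₁ : ω₁.IsTranslationInvariant) (h₂ : ω₂.IsTranslationInvariant)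
    (hρ₁ : 0 < ω₁.density) (hρ₁' : ω₁.density ≤ 1 / 4) (hρ₂ : 1 ≤ ω₂.density) (hρ₂' : ω₂.density < 2)
    {lam : ℝ} (hl0 : 0 < lam) (hl1 : lam < 1) :
    (mix lam hl0.le hl1.le ω₁ ω₂).entropyDensitySup -
        β * (mix lam hl0.le hl1.le ω₁ ω₂).meanEnergy (gcInteractionTT' 1 s U 0 hz) 1 <
      pressureTT'Zeeman β 1 s U (mix lam hl0.le hl1.le ω₁ ω₂).density hz := by
  refine psHT_not_fieldEquilibrium_mix_above_column_hotAnchor 1 (s₁ := -1 / 4) (s₂ := -1 / 5) (U₂ := 8) (U₃ := 81 / 10)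
    (n₁ := 1 / 4) (n₂ := 1) (a := 1 / 6) (b := 5 / 6) (β₀ := 30) (βh₁ := 0) (βh₂ := 2)
    (π₁ := 0.77) (π₂ := 3994878420865131 / 2251799813685248) (h₀ := 1 / 100)
    (by norm_num) (by norm_num) (by norm_num) (by norm_num) (by norm_num) (by norm_num) (by norm_num) (by norm_num)
    (by norm_num) (by norm_num) (by norm_num) (by norm_num) hβ (by norm_num)
    (lsco78_capPlane_on_cell_of hVB (by norm_num) (by norm_num) (by norm_num))
    (fun s hs => lsco_n1_law8_of hK8 h472 h428 s ⟨hs.1.trans' (by norm_num), hs.2.trans (by norm_num)⟩)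
    (fun s hs U hU => lsco_dilute14_floor_right (n₁ := 1 / 4) (by norm_num) (by norm_num) s hs U (by linarith [hU.1]))
    (lsco_diluteCap_1o4 (by norm_num))
    (lsco_hotCap_n1_b2_j300793_on_cell hC1 (by norm_num) (by norm_num) (by norm_num))
    hh ?_ ?_ hs hU h₁ h₂ hρ₁ hρ₁' hρ₂ hρ₂' hl0 hl1
  · intro s hs; obtain ⟨h1, h2⟩ := hs; push_cast; norm_num; nlinarith [h1, h2]
  · intro s hs; obtain ⟨h1, h2⟩ := hs; push_cast; norm_num; nlinarith [h1, h2]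

end Summit.Ventures.CertifiedManyBodySolver.Downfold
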